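import Summits.Ventures.YMGap.RobustBall.LoopScreeningDefs
import Summits.Ventures.YMGap.RobustBall.RectangleCode
import HarnessLib

/-!
# Venture YMGap, track ROBUST-BALL — loop screening IV: the loop term is a member of the tier-2 ball

HONEST FRAMING. WHAT THIS IS: a venture file (cell `pub-ymgap`, track Y2, seat lit-1 g5): bookkeeping
for the tier-2 area-law NO-GO (`RobustBall/AreaLawTierTwoNoGo.lean`). For `SU(N)` and the rectangle
`C = R × T` at `x` in the `(i, j)` plane, the loop term `W = t · W_C` (`LoopScreening.loopTerm`):

* `isLipBound_wilsonLoop` — `W_C` is coordinatewise Frobenius-Lipschitz with constant `2(R+T)` at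
  every link (telescoping `d_F(∏ aₖ, ∏ bₖ) ≤ ∑ d_F(aₖ, bₖ)` over the `2(R+T)` unitary letters, on
  p1's `LoopActivity.suFrobDist_mul_le / abs_re_trace_sub_le_suFrobDist`);
* `card_loopSites_le` (`#loopSites ≤ 2(R+T)`), `polymerDiam_loopSites_le` (`diam ≤ max R T`, `i ≠ j`,
  on p1's `RectangleCode.torusNorm_single_add_single_le`);
* `loopTerm_mem_clusterDomain` — **membership in the tier-2 ball**: if
  `2|t| e^{κ diam} ≤ ε₀` and `2(R+T)|t| e^{κ diam} (1 + d · #loopSites) ≤ ε₁` (`diam = polymerDiam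
  (loopSites …)`), then `W ∈ ClusterDomain κ ε₀ ε₁` (one polymer; the cross load counts the
  `d · #loopSites` links based at the loop's sites, the tree's incidence `polymersThroughEdge`).

Everything is proved; no definition, no named fact. [folklore]
-/

noncomputable section

open MeasureTheory Real Finset
open Literature.Probability.LatticeModels Literature.Probability.LatticeModels.DobrushinMetric
open Literature.MathematicalPhysics.QuantumFieldTheory
open Literature.MathematicalPhysics.QuantumLattice (fundamentalRep fundamentalRep_apply
  continuous_fundamentalRep)

namespace Summit.Ventures.YMGap.RobustBall

namespace LoopScreening

variable {d L N : ℕ}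

/-! ### Frobenius telescoping along the loop -/

section Lipschitz

/-- **Telescoping along a line**: the holonomies of two configurations differ in Frobenius distance by
at most the sum of the distances of their links. [folklore] -/
theorem suFrobDist_lineHolonomy_le (σ τ : GaugeConfig d L (SUN N)) (k : Fin d) :
    ∀ (n : ℕ) (y : Site d L),
      suFrobDist (lineHolonomy σ k n y) (lineHolonomy τ k n y) ≤
        ∑ s ∈ range n, suFrobDist (σ (y + Pi.single k ((s : ℕ) : ZMod L), k))
          (τ (y + Pi.single k ((s : ℕ) : ZMod L), k))
  | 0, y => by simp [suFrobDist_self]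
  | n + 1, y => by
      rw [lineHolonomy_succ, lineHolonomy_succ, Finset.sum_range_succ']
      simp only [Nat.cast_zero, Pi.single_zero, add_zero]
      refine (suFrobDist_mul_le _ _ _ _).trans ?_
      rw [add_comm]
      refine add_le_add ?_ le_rfl
      refine (suFrobDist_lineHolonomy_le σ τ k n (y.shift k)).trans (le_of_eq ?_)
      refine Finset.sum_congr rfl fun s _ => ?_
      rw [shift_add_single]

/-- Along a line, configurations agreeing off the link `e` differ by at most `n · d(σ_e, τ_e)`. [folklore] -/
theorem suFrobDist_lineHolonomy_le_of_eq_off {σ τ : GaugeConfig d L (SUN N)} {e : Edge d L}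
    (h : ∀ e', e' ≠ e → σ e' = τ e') (k : Fin d) (n : ℕ) (y : Site d L) :
    suFrobDist (lineHolonomy σ k n y) (lineHolonomy τ k n y) ≤ n * suFrobDist (σ e) (τ e) := by
  refine (suFrobDist_lineHolonomy_le σ τ k n y).trans ?_
  have hterm : ∀ s ∈ range n, suFrobDist (σ (y + Pi.single k ((s : ℕ) : ZMod L), k))
      (τ (y + Pi.single k ((s : ℕ) : ZMod L), k)) ≤ suFrobDist (σ e) (τ e) := by
    intro s _
    by_cases he : (y + Pi.single k ((s : ℕ) : ZMod L), k) = e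
    · rw [he]
    · rw [h _ he, suFrobDist_self]; exact suFrobDist_nonneg _ _
  calc _ ≤ ∑ _s ∈ range n, suFrobDist (σ e) (τ e) := Finset.sum_le_sum hterm
    _ = n * suFrobDist (σ e) (τ e) := by simp

/-- Four-letter telescoping `d(a b c⁻¹ e⁻¹, a' b' c'⁻¹ e'⁻¹) ≤ Σ d(letter, letter')` in `SU(N)`. [folklore] -/
theorem suFrobDist_word4_le (a b c e a' b' c' e' : SUN N) :
    suFrobDist (a * b * c⁻¹ * e⁻¹) (a' * b' * c'⁻¹ * e'⁻¹) ≤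
      suFrobDist a a' + suFrobDist b b' + suFrobDist c c' + suFrobDist e e' := by
  have h2 := suFrobDist_mul_le a b a' b'
  have h3 := suFrobDist_mul_le (a * b) c⁻¹ (a' * b') c'⁻¹
  have h4 := suFrobDist_mul_le (a * b * c⁻¹) e⁻¹ (a' * b' * c'⁻¹) e'⁻¹
  rw [suFrobDist_inv] at h3 h4
  linarith

/-- **The loop holonomy is `2(R+T)`-Lipschitz in every link** (Frobenius distances). [folklore] -/
theorem suFrobDist_rectangleHolonomy_le_of_eq_off {σ τ : GaugeConfig d L (SUN N)} {e : Edge d L}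
    (h : ∀ e', e' ≠ e → σ e' = τ e') (x : Site d L) (i j : Fin d) (R T : ℕ) :
    suFrobDist (rectangleHolonomy σ x i j R T) (rectangleHolonomy τ x i j R T) ≤
      (2 * (R + T) : ℕ) * suFrobDist (σ e) (τ e) := by
  have h1 := suFrobDist_lineHolonomy_le_of_eq_off h i R x
  have h2 := suFrobDist_lineHolonomy_le_of_eq_off h j T (x + Pi.single i ((R : ℕ) : ZMod L))
  have h3 := suFrobDist_lineHolonomy_le_of_eq_off h i R (x + Pi.single j ((T : ℕ) : ZMod L))
  have h4 := suFrobDist_lineHolonomy_le_of_eq_off h j T x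
  unfold rectangleHolonomy
  refine (suFrobDist_word4_le _ _ _ _ _ _ _ _).trans ?_
  calc _ ≤ (R : ℝ) * suFrobDist (σ e) (τ e) + T * suFrobDist (σ e) (τ e) + R * suFrobDist (σ e) (τ e) +
        T * suFrobDist (σ e) (τ e) := add_le_add (add_le_add (add_le_add h1 h2) h3) h4
    _ = _ := by push_cast; ring

/-- **The Wilson loop is coordinatewise Lipschitz** for the Frobenius distance, constant `2(R+T)`
at every link (via `|Re tr a - Re tr b| ≤ √N d_F(a, b)` of `LoopActivity` and `√N ≤ N`). [folklore] -/
theorem isLipBound_wilsonLoop (x : Site d L) (i j : Fin d) (R T : ℕ) (t : ℝ) :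
    IsLipBound suFrobDist
      (fun U : GaugeConfig d L (SUN N) => t * wilsonLoop (fundamentalRep (Fin N)) x i j R T U)
      fun _ => |t| * (2 * (R + T) : ℕ) where
  nonneg _ := by positivity
  le e σ τ h := by
    have hcore : |wilsonLoop (fundamentalRep (Fin N)) x i j R T σ -
        wilsonLoop (fundamentalRep (Fin N)) x i j R T τ| ≤ (2 * (R + T) : ℕ) * suFrobDist (σ e) (τ e) := by
      simp only [wilsonLoop, fundamentalRep_apply, ← mul_sub, abs_mul, abs_inv, Nat.abs_cast]
      rcases Nat.eq_zero_or_pos N with hN | hN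
      · subst hN
        simp only [Nat.cast_zero, inv_zero, zero_mul]
        exact mul_nonneg (by positivity) (suFrobDist_nonneg _ _)
      have hN' : (1 : ℝ) ≤ N := by exact_mod_cast hN
      have hsq : Real.sqrt N ≤ N := Real.sqrt_le_iff.2 ⟨by positivity, by nlinarith⟩
      have ht := abs_re_trace_sub_le_suFrobDist (rectangleHolonomy σ x i j R T) (rectangleHolonomy τ x i j R T)
      have hh := suFrobDist_rectangleHolonomy_le_of_eq_off h x i j R T
      calc (N : ℝ)⁻¹ * |((rectangleHolonomy σ x i j R T : SUN N) : Matrix (Fin N) (Fin N) ℂ).trace.re -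
              ((rectangleHolonomy τ x i j R T : SUN N) : Matrix (Fin N) (Fin N) ℂ).trace.re|
          ≤ (N : ℝ)⁻¹ * (N * ((2 * (R + T) : ℕ) * suFrobDist (σ e) (τ e))) :=
            mul_le_mul_of_nonneg_left (ht.trans (mul_le_mul hsq hh (suFrobDist_nonneg _ _) (by positivity)))
              (by positivity)
        _ = _ := by field_simp
    rw [← mul_sub, abs_mul, mul_assoc]
    exact mul_le_mul_of_nonneg_left hcore (abs_nonneg t)

end Lipschitz

/-! ### Size and diameter of the loop's site set -/

section Size

/-- The loop has at most `2(R+T)` base sites. [folklore] -/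
theorem card_loopSites_le (x : Site d L) (i j : Fin d) (R T : ℕ) :
    (loopSites x i j R T).card ≤ 2 * (R + T) := by
  unfold loopSites
  have hA : ((range R).image fun k : ℕ => x + Pi.single i ((k : ℕ) : ZMod L)).card ≤ R :=
    Finset.card_image_le.trans (Finset.card_range R).le
  have hB : ((range T).image fun k : ℕ =>
      x + Pi.single i ((R : ℕ) : ZMod L) + Pi.single j ((k : ℕ) : ZMod L)).card ≤ T :=
    Finset.card_image_le.trans (Finset.card_range T).le
  have hC : ((range R).image fun k : ℕ =>
      x + Pi.single j ((T : ℕ) : ZMod L) + Pi.single i ((k : ℕ) : ZMod L)).card ≤ R :=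
    Finset.card_image_le.trans (Finset.card_range R).le
  have hD : ((range T).image fun k : ℕ => x + Pi.single j ((k : ℕ) : ZMod L)).card ≤ T :=
    Finset.card_image_le.trans (Finset.card_range T).le
  calc _ ≤ _ := Finset.card_union_le _ _
    _ ≤ _ := add_le_add (Finset.card_union_le _ _) le_rfl
    _ ≤ _ := add_le_add (add_le_add (Finset.card_union_le _ _) le_rfl) le_rfl
    _ ≤ ((R + T) + R) + T := add_le_add (add_le_add (add_le_add hA hB) hC) hD
    _ = 2 * (R + T) := by ring

/-- Every base site of the loop is `x + a eᵢ + b eⱼ` with `a ≤ R`, `b ≤ T`. [folklore] -/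
theorem exists_offsets_of_mem_loopSites {x p : Site d L} {i j : Fin d} {R T : ℕ}
    (hp : p ∈ loopSites x i j R T) :
    ∃ a b : ℕ, a ≤ R ∧ b ≤ T ∧ p = x + (Pi.single i ((a : ℕ) : ZMod L) + Pi.single j ((b : ℕ) : ZMod L)) := by
  simp only [loopSites, mem_union, mem_image, mem_range] at hp
  rcases hp with ((⟨k, hk, rfl⟩ | ⟨k, hk, rfl⟩) | ⟨k, hk, rfl⟩) | ⟨k, hk, rfl⟩
  · exact ⟨k, 0, hk.le, Nat.zero_le _, by simp⟩
  · exact ⟨R, k, le_rfl, hk.le, by simp [add_assoc]⟩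
  · exact ⟨k, T, hk.le, le_rfl, by rw [add_assoc, add_comm (Pi.single j _)]⟩
  · exact ⟨0, k, Nat.zero_le _, hk.le, by simp⟩

/-- **The loop's site set has diameter `≤ max R T`.** [folklore] -/
theorem polymerDiam_loopSites_le {x : Site d L} {i j : Fin d} (hij : i ≠ j) (R T : ℕ) :
    polymerDiam (loopSites x i j R T) ≤ max R T := by
  refine Finset.sup_le fun p hp => Finset.sup_le fun q hq => ?_
  obtain ⟨a, b, ha, hb, rfl⟩ := exists_offsets_of_mem_loopSites hp
  obtain ⟨a', b', ha', hb', rfl⟩ := exists_offsets_of_mem_loopSites hq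
  have hrw : x + (Pi.single i ((a : ℕ) : ZMod L) + Pi.single j ((b : ℕ) : ZMod L)) -
      (x + (Pi.single i ((a' : ℕ) : ZMod L) + Pi.single j ((b' : ℕ) : ZMod L))) =
      (Pi.single i (((a : ℤ) - a' : ℤ) : ZMod L) : Site d L) + Pi.single j (((b : ℤ) - b' : ℤ) : ZMod L) := by
    simp only [Int.cast_sub, Int.cast_natCast, Pi.single_sub]
    abel
  rw [hrw]
  refine (torusNorm_single_add_single_le hij _ _).trans (max_le_max ?_ ?_) <;> omega

/-- At block scale `1`, the links of a polymer are the links based at its sites: `#X · d` of them. [folklore] -/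
theorem card_polymerEdges_one [NeZero L] (X : Finset (Site d L)) : (polymerEdges 1 X).card = X.card * d := by
  have h : polymerEdges (d := d) (L := L) 1 X = X ×ˢ (univ : Finset (Fin d)) := by
    ext ⟨y, k⟩
    simp [mem_polymerEdges_iff]
  rw [h, Finset.card_product, Finset.card_univ, Fintype.card_fin]

end Size

/-! ### Membership in the tier-2 ball -/

section Member

variable [NeZero L]

/-- **The loop term is a member of the tier-2 ball** when its coefficient is small against the
weight `e^{κ · diam}` and the perimeter: oscillation load `≤ 2|t| e^{κ diam}`, Lipschitz loads
`≤ 2(R+T)|t| e^{κ diam} (1 + d · #loopSites)`. [folklore] -/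
theorem loopTerm_mem_clusterDomain (t : ℝ) (x : Site d L) (i j : Fin d) (R T : ℕ) {κ ε₀ ε₁ : ℝ}
    (h₀ : 2 * |t| * Real.exp (κ * polymerDiam (loopSites x i j R T)) ≤ ε₀)
    (h₁ : |t| * (2 * (R + T) : ℕ) * Real.exp (κ * polymerDiam (loopSites x i j R T)) *
      (1 + ((loopSites x i j R T).card * d : ℕ)) ≤ ε₁) :
    loopTerm (fundamentalRep (Fin N)) (continuous_fundamentalRep (Fin N)) t x i j R T ∈
      ClusterDomain (d := d) (L := L) (N := N) κ ε₀ ε₁ := by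
  classical
  have hE0 : 0 ≤ Real.exp (κ * polymerDiam (loopSites x i j R T)) := Real.exp_nonneg _
  have hℓ0 : 0 ≤ |t| * (2 * (R + T) : ℕ) := by positivity
  -- the witness
  let osc : Finset (Site d L) → Edge d L → ℝ := fun X _ => if X = loopSites x i j R T then 2 * |t| else 0
  let lip : Finset (Site d L) → Edge d L → ℝ := fun X _ =>
    if X = loopSites x i j R T then |t| * (2 * (R + T) : ℕ) else 0
  have hact : ∀ X, (loopTerm (fundamentalRep (Fin N)) (continuous_fundamentalRep (Fin N)) t x i j R T).act X =
      fun U => if X = loopSites x i j R T then t * wilsonLoop (fundamentalRep (Fin N)) x i j R T U else 0 :=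
    fun X => rfl
  have hosc : ∀ X, Dobrushin.IsOscBound
      ((loopTerm (fundamentalRep (Fin N)) (continuous_fundamentalRep (Fin N)) t x i j R T).act X) (osc X) := by
    intro X
    by_cases hX : X = loopSites x i j R T
    · have h2 : osc X = fun _ => 2 * |t| := funext fun _ => if_pos hX
      rw [hact, h2]
      simp only [hX, if_true]
      exact Dobrushin.IsOscBound.of_abs_le (abs_nonneg t) fun U => by
        rw [abs_mul]
        exact mul_le_of_le_one_right (abs_nonneg t)
          (abs_wilsonLoop_le_one _ (fun g => by rw [fundamentalRep_apply]; exact abs_re_trace_su_le g)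
            x i j R T U)
    · have h2 : osc X = fun _ => 0 := funext fun _ => if_neg hX
      rw [hact, h2]
      simp only [hX, if_false]
      exact ⟨fun _ => le_rfl, fun y σ τ _ => by simp⟩
  have hlip : ∀ X, IsLipBound suFrobDist
      ((loopTerm (fundamentalRep (Fin N)) (continuous_fundamentalRep (Fin N)) t x i j R T).act X) (lip X) := by
    intro X
    by_cases hX : X = loopSites x i j R T
    · have h2 : lip X = fun _ => |t| * (2 * (R + T) : ℕ) := funext fun _ => if_pos hX
      rw [hact, h2]
      simp only [hX, if_true]
      exact isLipBound_wilsonLoop x i j R T t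
    · have h2 : lip X = fun _ => 0 := funext fun _ => if_neg hX
      rw [hact, h2]
      simp only [hX, if_false]
      exact ⟨fun _ => le_rfl, fun y σ τ _ => by simp⟩
  refine ⟨⟨osc, lip, hosc, hlip⟩, fun e => ?_, fun e => ?_⟩
  · -- oscillation load
    show ∑ X ∈ polymersThroughEdge e, Real.exp (κ * polymerDiam X) * osc X e ≤ ε₀
    have hrw : ∀ X ∈ polymersThroughEdge e, Real.exp (κ * polymerDiam X) * osc X e =
        if X = loopSites x i j R T then Real.exp (κ * polymerDiam (loopSites x i j R T)) * (2 * |t|) else 0 := by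
      intro X _
      by_cases hX : X = loopSites x i j R T
      · subst hX; simp [osc]
      · simp [osc, hX]
    rw [Finset.sum_congr rfl hrw, Finset.sum_ite_eq']
    split_ifs
    · linarith
    · exact le_trans (by positivity) h₀
  · -- Lipschitz loads
    have hself : ∑ X ∈ polymersThroughEdge e, Real.exp (κ * polymerDiam X) * lip X e ≤
        Real.exp (κ * polymerDiam (loopSites x i j R T)) * (|t| * (2 * (R + T) : ℕ)) := by
      have hrw : ∀ X ∈ polymersThroughEdge e, Real.exp (κ * polymerDiam X) * lip X e =
          if X = loopSites x i j R T then
            Real.exp (κ * polymerDiam (loopSites x i j R T)) * (|t| * (2 * (R + T) : ℕ)) else 0 := by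
        intro X _
        by_cases hX : X = loopSites x i j R T
        · subst hX; simp [lip]
        · simp [lip, hX]
      rw [Finset.sum_congr rfl hrw, Finset.sum_ite_eq']
      split_ifs
      · exact le_rfl
      · positivity
    have hcross : ∀ y, (∑ X ∈ (polymersThroughEdge e).filter (fun X => y ∈ polymerEdges 1 X),
        Real.exp (κ * polymerDiam X) * lip X y) ≤
        if y ∈ polymerEdges 1 (loopSites x i j R T) then
          Real.exp (κ * polymerDiam (loopSites x i j R T)) * (|t| * (2 * (R + T) : ℕ)) else 0 := by
      intro y
      have hrw : ∀ X ∈ (polymersThroughEdge e).filter (fun X => y ∈ polymerEdges 1 X),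
          Real.exp (κ * polymerDiam X) * lip X y =
          if X = loopSites x i j R T then
            Real.exp (κ * polymerDiam (loopSites x i j R T)) * (|t| * (2 * (R + T) : ℕ)) else 0 := by
        intro X _
        by_cases hX : X = loopSites x i j R T
        · subst hX; simp [lip]
        · simp [lip, hX]
      rw [Finset.sum_congr rfl hrw, Finset.sum_ite_eq']
      by_cases hy : y ∈ polymerEdges 1 (loopSites x i j R T)
      · simp only [hy, if_true]
        split_ifs
        · exact le_rfl
        · positivity
      · have : loopSites x i j R T ∉ (polymersThroughEdge e).filter (fun X => y ∈ polymerEdges 1 X) := by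
          rw [Finset.mem_filter]; exact fun h => hy h.2
        simp only [this, if_false, hy]; exact le_rfl
    have hcrossLoad : ∑ y ∈ univ.erase e, (∑ X ∈ (polymersThroughEdge e).filter (fun X => y ∈ polymerEdges 1 X),
        Real.exp (κ * polymerDiam X) * lip X y) ≤
        (polymerEdges 1 (loopSites x i j R T)).card *
          (Real.exp (κ * polymerDiam (loopSites x i j R T)) * (|t| * (2 * (R + T) : ℕ))) := by
      calc _ ≤ ∑ y ∈ univ.erase e, (if y ∈ polymerEdges 1 (loopSites x i j R T) then
              Real.exp (κ * polymerDiam (loopSites x i j R T)) * (|t| * (2 * (R + T) : ℕ)) else 0) :=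
            Finset.sum_le_sum fun y _ => hcross y
        _ ≤ ∑ y, (if y ∈ polymerEdges 1 (loopSites x i j R T) then
              Real.exp (κ * polymerDiam (loopSites x i j R T)) * (|t| * (2 * (R + T) : ℕ)) else 0) :=
            Finset.sum_le_sum_of_subset_of_nonneg (Finset.erase_subset _ _) fun y _ _ => by positivity
        _ = _ := by
            rw [Finset.sum_ite_mem, Finset.univ_inter, Finset.sum_const, nsmul_eq_mul]
    show (∑ X ∈ polymersThroughEdge e, Real.exp (κ * polymerDiam X) * lip X e) +
        ∑ y ∈ univ.erase e, (∑ X ∈ (polymersThroughEdge e).filter (fun X => y ∈ polymerEdges 1 X),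
          Real.exp (κ * polymerDiam X) * lip X y) ≤ ε₁
    calc _ ≤ Real.exp (κ * polymerDiam (loopSites x i j R T)) * (|t| * (2 * (R + T) : ℕ)) +
          (polymerEdges 1 (loopSites x i j R T)).card *
            (Real.exp (κ * polymerDiam (loopSites x i j R T)) * (|t| * (2 * (R + T) : ℕ))) :=
          add_le_add hself hcrossLoad
      _ = |t| * (2 * (R + T) : ℕ) * Real.exp (κ * polymerDiam (loopSites x i j R T)) *
          (1 + (((loopSites x i j R T).card * d : ℕ) : ℝ)) := by
          rw [card_polymerEdges_one]; push_cast; ring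
      _ ≤ ε₁ := h₁

end Member


end LoopScreening

end Summit.Ventures.YMGap.RobustBall
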